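import Literature.IUT.HodgeTheaters.PiAvatarKitCoreThetaProp67
import Literature.IUT.HodgeTheaters.InitialThetaDataDecompositionCharacters
import HarnessLib

/-!
# [IUTchI] Proposition 6.7 AS PRINTED, INSTANTIATED at the single-point cusp model `regeom₄`: the Prop 6.7 body of
# `PiAvatarKitCoreThetaProp67` (Def 4.6 (ii) as typed in §4 · kit reading · «well-defined up to a unique isomorphism» · non-vacuity of the
# bridge quantifier) UNCONDITIONAL at the model's genuine Θ-NF stand-in kit modulo a displayed order-`l` character family
# (node IUTchI:Prop6.7 «P67-BODY-AT-MODEL»; proof-only; post-freeze additive, not a cone member)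

S. Mochizuki, *Inter-universal Teichmüller theory I*, kurims manuscript (May 2020), Proposition 6.7 p. 167 l. 22–33, Definition 4.6 (ii) p. 111,
Example 4.4 (i)(ii)(iv) pp. 106–107, Proposition 4.8 (ii) p. 115, Example 6.2 (i) p. 160. ([IUTchI] Prop 6.7 p.167) [claim: Mochizuki2012,
status: disputed] (D-0012 claim key, series status DISPUTED — kernel theorems over abc-iut-L5-t2's REAL `InitialThetaData` at abc-iut-L5-t8's
single-point cusp model `regeom₄` (`InitialThetaDataTorsionCuspModelPoint*`, p469671–p477346) with abc-iut-w4-d077's evaluation-section binders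
`evalSectionBinderRegeom₄` (p475487) and abc-iut-L5-d1's order-`l` character family (`InitialThetaDataDecompositionCharacters`, p486714); nothing of the series is asserted, no side is taken on [IUTchIII] Cor. 3.12).

## What and why (L5-lead TOKEN RULE of 2026-08-27T00:04:43Z: «PROVED at the genuine kit AS PRINTED + DATA/LAW binders JOINTLY NON-VACUOUS at one datum»)

`PiAvatarKitCoreThetaProp67` (abc-iut-w4-d054) proves Prop 6.7 AS PRINTED at the Θ-NF stand-in kit of ANY real initial Θ-data modulo the
displayed binders {`CG`, `hS`, `M`, `hA`, `hI`} ∪ {`ES`}.  abc-iut-L5-t8's `InitialThetaDataTorsionCuspModelPointKitCore` (p477346) instantiates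
(C″)'s variables at `D := D₀.regeom₄` by the stage-C named terms (`cuspGaloisRegeom₄`, `cuspClassesNormaliserStable_regeom₄`,
`unramifiedTorsionMonodromyRegeom₄.toTorsionMonodromy`, `arrowCoveringClaimsRegeom₄`, `tau_inertia`) and `ES := fun v hv => evalSectionBinderRegeom₄ v
(χ v hv) (hχ v hv)` from a displayed nontrivial `ℤ/l`-character `χ_v` on each bad decomposition group, and proves there (γ), `KitCore` inhabited,
gluing uniqueness and the JOINT binder telescope `exists_sec6_and_K3_hypotheses_jointly_of_characters`.  THIS FILE reads the Prop 6.7 BODY at the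
same data, modulo `(χ, hχ)` ONLY:

* `thetaBridgeAlgorithm_thetaStandIn_regeom₄` — Prop 6.7 with Def 4.6 (ii) AS TYPED IN §4 at the model's genuine Θ-NF stand-in kit;
* `thetaBridgeAlgorithm_isModelConjugate_thetaStandIn_regeom₄` — the kit reading;
* `card_thetaBridgeData_hom_thetaStandIn_regeom₄` — «well-defined, up to a unique isomorphism» (`Nat.card = 1`);
* `nonempty_dThetaPMBridge_thetaStandIn_regeom₄` — the bridge quantifier is not vacuous there (Example 6.2 (i));
* `prop67_body_regeom₄` — the four clauses together with law (γ) as ONE conjunction «[model; mod χ]»;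
* `exists_evalSections_prop67_body_regeom₄` — **χ-FREE, BINDER-FREE «[model]»**: with the character family supplied by abc-iut-L5-d1's
  `exists_decompAt_characterFamily_ne_one` (p486714), there EXISTS an Example-4.4 evaluation-section family `ES` at the model for which law (γ)
  and the whole printed Prop 6.7 body hold over OUR typed interface — no hypothesis displayed at all.

HONEST TAG: «[model; mod χ]» — a MODEL (E[l]-twisted finite shadow, single-point inertia) witnesses that OUR typed binders are jointly satisfiable
and that the printed Prop 6.7 body holds over OUR typed interface there; it does NOT assert the binders are inhabited at the tempered fundamental
groups of the actual once-punctured elliptic curve, and a stand-in is NOT print's `ℬ^temp(X̳_v̲)⁰`.  Proof-only (no `def`, no instance, no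
notation, no new binder, no `Prop` fact); everything BY NAME; every `theorem` is kernel-checked; typed ≠ inhabited ≠ proved; binder ≠ fact.
-/

noncomputable section

namespace Literature.IUT.HodgeTheaters

open CategoryTheory

universe u

namespace InitialThetaData

open Literature.AnabelianGeometry.AbsoluteAnabelian TorsionMonodromyModel TorsionCuspModel
open scoped WeierstrassCurve.Affine Classical

variable {F K Fbar : Type u} [Field F] [NumberField F] [Field K] [NumberField K] [Algebra F K] [Field Fbar]
  [Algebra F Fbar] [Algebra K Fbar] {E : WeierstrassCurve F} [E.IsElliptic] {l : ℕ} {Pb : BadPlacePredicates K}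
  (D₀ : InitialThetaData F K Fbar E l Pb) [Fact l.Prime]
  (χ : ∀ v : D₀.regeom₄.IndexCopy, v ∈ D₀.regeom₄.indexCopyBad → (↥(D₀.regeom₄.decompAt v) →* Multiplicative (ZMod l)))
  (hχ : ∀ v (hv : v ∈ D₀.regeom₄.indexCopyBad), χ v hv ≠ 1)

/-! ## §1. The Prop 6.7 body at `regeom₄`, modulo `(χ, hχ)` only -/

/-- **[IUTchI] Prop 6.7 with Def 4.6 (ii) AS TYPED IN §4, at the model `regeom₄`**: for EVERY `𝒟-Θ^±`-bridge of the model's genuine Θ-NF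
stand-in kit, the algorithm's output is, place by place, the image of an honest §4 `𝒟-Θ`-bridge over the genuine §4 datum — abc-iut-w4-d054's
`thetaBridgeAlgorithm_thetaStandIn` BY NAME at abc-iut-L5-t8's (C″)-at-`regeom₄` data. «[model; mod χ]».
([IUTchI] Prop 6.7 p.167) [claim: Mochizuki2012, status: disputed] -/
theorem thetaBridgeAlgorithm_thetaStandIn_regeom₄ :
    PMBaseKit.DThetaPMBridge.ThetaBridgeAlgorithm
      (D₀.regeom₄.multKitThetaNFStandIn D₀.cuspGaloisRegeom₄ D₀.cuspClassesNormaliserStable_regeom₄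
        D₀.unramifiedTorsionMonodromyRegeom₄.toTorsionMonodromy D₀.arrowCoveringClaimsRegeom₄
        (D₀.unramifiedTorsionMonodromyRegeom₄.tau_inertia _)
        (fun v hv => D₀.evalSectionBinderRegeom₄ v (χ v hv) (hχ v hv)))
      (fun Dt => ∃ (B' : (D₀.regeom₄.baseThetaDatumThetaStandIn D₀.cuspGaloisRegeom₄ D₀.cuspClassesNormaliserStable_regeom₄
            D₀.unramifiedTorsionMonodromyRegeom₄.toTorsionMonodromy D₀.arrowCoveringClaimsRegeom₄
            (D₀.unramifiedTorsionMonodromyRegeom₄.tau_inertia _)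
            (fun v hv => D₀.evalSectionBinderRegeom₄ v (χ v hv) (hχ v hv))).DThetaBridge) (ι : Dt.J ≃ B'.J)
          (κ : ∀ j x, (B'.capsule (ι j) x).obj ≅ (Dt.capsule j).obj x)
          (γ : ∀ x, (B'.cod x).obj ≅ Dt.codomain.obj x),
          ∀ j x, Dt.poly j x = {g | ∃ f ∈ B'.poly (ι j) x, g = (κ j x).inv ≫ f.hom ≫ (γ x).hom})
      D₀.regeom₄.odd_l :=
  D₀.regeom₄.thetaBridgeAlgorithm_thetaStandIn _ _ _ _ _ _

/-- **Prop 6.7, Def 4.6 (ii) in the KIT READING, at the model `regeom₄`** — abc-iut-w4-d054's `thetaBridgeAlgorithm_isModelConjugate_thetaStandIn`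
BY NAME. «[model; mod χ]». ([IUTchI] Prop 6.7 p.167) [claim: Mochizuki2012, status: disputed] -/
theorem thetaBridgeAlgorithm_isModelConjugate_thetaStandIn_regeom₄ :
    PMBaseKit.DThetaPMBridge.ThetaBridgeAlgorithm
      (D₀.regeom₄.multKitThetaNFStandIn D₀.cuspGaloisRegeom₄ D₀.cuspClassesNormaliserStable_regeom₄
        D₀.unramifiedTorsionMonodromyRegeom₄.toTorsionMonodromy D₀.arrowCoveringClaimsRegeom₄
        (D₀.unramifiedTorsionMonodromyRegeom₄.tau_inertia _)
        (fun v hv => D₀.evalSectionBinderRegeom₄ v (χ v hv) (hχ v hv)))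
      (fun Dt => ∃ (e : Dt.J ≃ Fin ((l - 1) / 2))
          (κ : ∀ j, (PMBaseKit.DStrip.model (D₀.regeom₄.baseKitThetaNFStandIn D₀.cuspGaloisRegeom₄
            D₀.cuspClassesNormaliserStable_regeom₄ D₀.unramifiedTorsionMonodromyRegeom₄.toTorsionMonodromy
            D₀.arrowCoveringClaimsRegeom₄ (D₀.unramifiedTorsionMonodromyRegeom₄.tau_inertia _))).Iso (Dt.capsule j))
          (δ : (PMBaseKit.DStrip.model (D₀.regeom₄.baseKitThetaNFStandIn D₀.cuspGaloisRegeom₄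
            D₀.cuspClassesNormaliserStable_regeom₄ D₀.unramifiedTorsionMonodromyRegeom₄.toTorsionMonodromy
            D₀.arrowCoveringClaimsRegeom₄ (D₀.unramifiedTorsionMonodromyRegeom₄.tau_inertia _))).Iso Dt.codomain),
        (∀ (j : Dt.J) (x : D₀.regeom₄.IndexCopy) (hx : x ∈ D₀.regeom₄.indexCopyBad), Dt.poly j x =
            {h | ∃ g ∈ (D₀.regeom₄.multKitThetaNFStandIn D₀.cuspGaloisRegeom₄ D₀.cuspClassesNormaliserStable_regeom₄
                D₀.unramifiedTorsionMonodromyRegeom₄.toTorsionMonodromy D₀.arrowCoveringClaimsRegeom₄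
                (D₀.unramifiedTorsionMonodromyRegeom₄.tau_inertia _)
                (fun v hv => D₀.evalSectionBinderRegeom₄ v (χ v hv) (hχ v hv))).thetaPolyBad (e j) x hx,
              h = (κ j x).inv ≫ g ≫ (δ x).hom}) ∧
        (∀ (j : Dt.J) (x : D₀.regeom₄.IndexCopy), x ∉ D₀.regeom₄.indexCopyBad → Dt.poly j x =
            {h | ∃ g : (D₀.regeom₄.baseKitThetaNFStandIn D₀.cuspGaloisRegeom₄ D₀.cuspClassesNormaliserStable_regeom₄
                  D₀.unramifiedTorsionMonodromyRegeom₄.toTorsionMonodromy D₀.arrowCoveringClaimsRegeom₄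
                  (D₀.unramifiedTorsionMonodromyRegeom₄.tau_inertia _)).model x ≅
                (D₀.regeom₄.baseKitThetaNFStandIn D₀.cuspGaloisRegeom₄ D₀.cuspClassesNormaliserStable_regeom₄
                  D₀.unramifiedTorsionMonodromyRegeom₄.toTorsionMonodromy D₀.arrowCoveringClaimsRegeom₄
                  (D₀.unramifiedTorsionMonodromyRegeom₄.tau_inertia _)).model x,
              h = (κ j x).inv ≫ g.hom ≫ (δ x).hom}))
      D₀.regeom₄.odd_l :=
  D₀.regeom₄.thetaBridgeAlgorithm_isModelConjugate_thetaStandIn _ _ _ _ _ _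

/-- **«well-defined, up to a UNIQUE isomorphism» at the model `regeom₄`**: between the outputs at any two `𝒟-Θ^±`-bridges of the model's
genuine Θ-NF stand-in kit there is EXACTLY ONE Def-4.6 (ii) morphism — abc-iut-w4-d054's `card_thetaBridgeData_hom_thetaStandIn` BY NAME.
«[model; mod χ]». ([IUTchI] Prop 6.7 p.167) [claim: Mochizuki2012, status: disputed] -/
theorem card_thetaBridgeData_hom_thetaStandIn_regeom₄
    (B₁ B₂ : (D₀.regeom₄.baseKitThetaNFStandIn D₀.cuspGaloisRegeom₄ D₀.cuspClassesNormaliserStable_regeom₄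
        D₀.unramifiedTorsionMonodromyRegeom₄.toTorsionMonodromy D₀.arrowCoveringClaimsRegeom₄
        (D₀.unramifiedTorsionMonodromyRegeom₄.tau_inertia _)).DThetaPMBridge) :
    Nat.card (PMBaseKit.DThetaBridgeData.Hom
      (B₁.thetaBridgeData (D₀.regeom₄.multKitThetaNFStandIn D₀.cuspGaloisRegeom₄ D₀.cuspClassesNormaliserStable_regeom₄
        D₀.unramifiedTorsionMonodromyRegeom₄.toTorsionMonodromy D₀.arrowCoveringClaimsRegeom₄
        (D₀.unramifiedTorsionMonodromyRegeom₄.tau_inertia _)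
        (fun v hv => D₀.evalSectionBinderRegeom₄ v (χ v hv) (hχ v hv))) D₀.regeom₄.odd_l)
      (B₂.thetaBridgeData (D₀.regeom₄.multKitThetaNFStandIn D₀.cuspGaloisRegeom₄ D₀.cuspClassesNormaliserStable_regeom₄
        D₀.unramifiedTorsionMonodromyRegeom₄.toTorsionMonodromy D₀.arrowCoveringClaimsRegeom₄
        (D₀.unramifiedTorsionMonodromyRegeom₄.tau_inertia _)
        (fun v hv => D₀.evalSectionBinderRegeom₄ v (χ v hv) (hχ v hv))) D₀.regeom₄.odd_l)) = 1 :=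
  D₀.regeom₄.card_thetaBridgeData_hom_thetaStandIn _ _ _ _ _ _ B₁ B₂

omit [Fact l.Prime] in
/-- **The bridge quantifier of Prop 6.7 is NOT VACUOUS at the model `regeom₄`** (Example 6.2 (i)'s model `𝒟-Θ^±`-bridge over the model's
Θ-NF stand-in kit) — abc-iut-w4-d054's `nonempty_dThetaPMBridge_thetaStandIn` BY NAME. «[model]».
([IUTchI] Ex 6.2 (i) p.160) [claim: Mochizuki2012, status: disputed] -/
theorem nonempty_dThetaPMBridge_thetaStandIn_regeom₄ [Fact l.Prime] :
    Nonempty (D₀.regeom₄.baseKitThetaNFStandIn D₀.cuspGaloisRegeom₄ D₀.cuspClassesNormaliserStable_regeom₄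
        D₀.unramifiedTorsionMonodromyRegeom₄.toTorsionMonodromy D₀.arrowCoveringClaimsRegeom₄
        (D₀.unramifiedTorsionMonodromyRegeom₄.tau_inertia _)).DThetaPMBridge :=
  D₀.regeom₄.nonempty_dThetaPMBridge_thetaStandIn _ _ _ _ _

/-- **THE PROP 6.7 BODY AT THE MODEL, as one conjunction** — (γ) `ThetaAgrees` ∧ Prop 6.7 with Def 4.6 (ii) AS TYPED IN §4 ∧ «well-defined
up to a unique isomorphism» (∀ B₁ B₂, `Nat.card Hom = 1`) ∧ the bridge quantifier inhabited, at `D := D₀.regeom₄` with the (C″) variables the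
stage-C named terms and `ES` abc-iut-w4-d077's term — modulo the displayed `(χ, hχ)` ONLY. «[model; mod χ]».
([IUTchI] Prop 6.7 p.167) [claim: Mochizuki2012, status: disputed] -/
theorem prop67_body_regeom₄ :
    (D₀.regeom₄.kitCoreThetaStandIn D₀.cuspGaloisRegeom₄ D₀.cuspClassesNormaliserStable_regeom₄
        D₀.unramifiedTorsionMonodromyRegeom₄.toTorsionMonodromy D₀.arrowCoveringClaimsRegeom₄
        (D₀.unramifiedTorsionMonodromyRegeom₄.tau_inertia _)
        (fun v hv => D₀.evalSectionBinderRegeom₄ v (χ v hv) (hχ v hv))).ThetaAgrees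
      (D₀.regeom₄.multKitThetaNFStandIn D₀.cuspGaloisRegeom₄ D₀.cuspClassesNormaliserStable_regeom₄
        D₀.unramifiedTorsionMonodromyRegeom₄.toTorsionMonodromy D₀.arrowCoveringClaimsRegeom₄
        (D₀.unramifiedTorsionMonodromyRegeom₄.tau_inertia _)
        (fun v hv => D₀.evalSectionBinderRegeom₄ v (χ v hv) (hχ v hv))) ∧
    PMBaseKit.DThetaPMBridge.ThetaBridgeAlgorithm
      (D₀.regeom₄.multKitThetaNFStandIn D₀.cuspGaloisRegeom₄ D₀.cuspClassesNormaliserStable_regeom₄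
        D₀.unramifiedTorsionMonodromyRegeom₄.toTorsionMonodromy D₀.arrowCoveringClaimsRegeom₄
        (D₀.unramifiedTorsionMonodromyRegeom₄.tau_inertia _)
        (fun v hv => D₀.evalSectionBinderRegeom₄ v (χ v hv) (hχ v hv)))
      (fun Dt => ∃ (B' : (D₀.regeom₄.baseThetaDatumThetaStandIn D₀.cuspGaloisRegeom₄ D₀.cuspClassesNormaliserStable_regeom₄
            D₀.unramifiedTorsionMonodromyRegeom₄.toTorsionMonodromy D₀.arrowCoveringClaimsRegeom₄
            (D₀.unramifiedTorsionMonodromyRegeom₄.tau_inertia _)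
            (fun v hv => D₀.evalSectionBinderRegeom₄ v (χ v hv) (hχ v hv))).DThetaBridge) (ι : Dt.J ≃ B'.J)
          (κ : ∀ j x, (B'.capsule (ι j) x).obj ≅ (Dt.capsule j).obj x)
          (γ : ∀ x, (B'.cod x).obj ≅ Dt.codomain.obj x),
          ∀ j x, Dt.poly j x = {g | ∃ f ∈ B'.poly (ι j) x, g = (κ j x).inv ≫ f.hom ≫ (γ x).hom})
      D₀.regeom₄.odd_l ∧
    (∀ B₁ B₂ : (D₀.regeom₄.baseKitThetaNFStandIn D₀.cuspGaloisRegeom₄ D₀.cuspClassesNormaliserStable_regeom₄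
        D₀.unramifiedTorsionMonodromyRegeom₄.toTorsionMonodromy D₀.arrowCoveringClaimsRegeom₄
        (D₀.unramifiedTorsionMonodromyRegeom₄.tau_inertia _)).DThetaPMBridge,
      Nat.card (PMBaseKit.DThetaBridgeData.Hom
        (B₁.thetaBridgeData (D₀.regeom₄.multKitThetaNFStandIn D₀.cuspGaloisRegeom₄ D₀.cuspClassesNormaliserStable_regeom₄
          D₀.unramifiedTorsionMonodromyRegeom₄.toTorsionMonodromy D₀.arrowCoveringClaimsRegeom₄
          (D₀.unramifiedTorsionMonodromyRegeom₄.tau_inertia _)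
          (fun v hv => D₀.evalSectionBinderRegeom₄ v (χ v hv) (hχ v hv))) D₀.regeom₄.odd_l)
        (B₂.thetaBridgeData (D₀.regeom₄.multKitThetaNFStandIn D₀.cuspGaloisRegeom₄ D₀.cuspClassesNormaliserStable_regeom₄
          D₀.unramifiedTorsionMonodromyRegeom₄.toTorsionMonodromy D₀.arrowCoveringClaimsRegeom₄
          (D₀.unramifiedTorsionMonodromyRegeom₄.tau_inertia _)
          (fun v hv => D₀.evalSectionBinderRegeom₄ v (χ v hv) (hχ v hv))) D₀.regeom₄.odd_l)) = 1) ∧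
    Nonempty (D₀.regeom₄.baseKitThetaNFStandIn D₀.cuspGaloisRegeom₄ D₀.cuspClassesNormaliserStable_regeom₄
        D₀.unramifiedTorsionMonodromyRegeom₄.toTorsionMonodromy D₀.arrowCoveringClaimsRegeom₄
        (D₀.unramifiedTorsionMonodromyRegeom₄.tau_inertia _)).DThetaPMBridge :=
  ⟨D₀.thetaAgrees_thetaStandIn_regeom₄ χ hχ, D₀.thetaBridgeAlgorithm_thetaStandIn_regeom₄ χ hχ,
    D₀.card_thetaBridgeData_hom_thetaStandIn_regeom₄ χ hχ, D₀.nonempty_dThetaPMBridge_thetaStandIn_regeom₄⟩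

/-! ## §2. χ-free: the Prop 6.7 body at the model for SOME evaluation-section family, no hypothesis displayed -/

/-- **THE PROP 6.7 BODY AT THE MODEL, BINDER-FREE «[model]»**: at the single-point cusp model `D₀.regeom₄` (for EVERY real initial Θ-data `D₀`),
with (C″)'s kit variables the stage-C named TERMS, there EXISTS a family of Example-4.4 evaluation-section binders `ES` on the bad decomposition
groups — abc-iut-w4-d077's `evalSectionBinderRegeom₄` fed with abc-iut-L5-d1's order-`l` characters `exists_decompAt_characterFamily_ne_one`
(p486714) — such that law (γ) `ThetaAgrees` ∧ Prop 6.7 with Def 4.6 (ii) AS TYPED IN §4 ∧ «well-defined up to a unique isomorphism»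
(`Nat.card Hom = 1`) ∧ the bridge quantifier inhabited ALL HOLD over OUR typed interface.  No `χ`, no law, no binder displayed.  A model witnesses
OUR typed binders and the printed body over OUR interface only. ([IUTchI] Prop 6.7 p.167) [claim: Mochizuki2012, status: disputed] -/
theorem exists_evalSections_prop67_body_regeom₄ :
    ∃ ES : ∀ v (_ : v ∈ D₀.regeom₄.indexCopyBad),
        EvalSectionBinder
          (D₀.regeom₄.localDataStandIn D₀.cuspGaloisRegeom₄ D₀.cuspClassesNormaliserStable_regeom₄
            D₀.unramifiedTorsionMonodromyRegeom₄.toTorsionMonodromy D₀.arrowCoveringClaimsRegeom₄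
            (D₀.unramifiedTorsionMonodromyRegeom₄.tau_inertia _) v)
          (D₀.regeom₄.decompAt v),
      (D₀.regeom₄.kitCoreThetaStandIn D₀.cuspGaloisRegeom₄ D₀.cuspClassesNormaliserStable_regeom₄
          D₀.unramifiedTorsionMonodromyRegeom₄.toTorsionMonodromy D₀.arrowCoveringClaimsRegeom₄
          (D₀.unramifiedTorsionMonodromyRegeom₄.tau_inertia _) ES).ThetaAgrees
        (D₀.regeom₄.multKitThetaNFStandIn D₀.cuspGaloisRegeom₄ D₀.cuspClassesNormaliserStable_regeom₄
          D₀.unramifiedTorsionMonodromyRegeom₄.toTorsionMonodromy D₀.arrowCoveringClaimsRegeom₄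
          (D₀.unramifiedTorsionMonodromyRegeom₄.tau_inertia _) ES) ∧
      PMBaseKit.DThetaPMBridge.ThetaBridgeAlgorithm
        (D₀.regeom₄.multKitThetaNFStandIn D₀.cuspGaloisRegeom₄ D₀.cuspClassesNormaliserStable_regeom₄
          D₀.unramifiedTorsionMonodromyRegeom₄.toTorsionMonodromy D₀.arrowCoveringClaimsRegeom₄
          (D₀.unramifiedTorsionMonodromyRegeom₄.tau_inertia _) ES)
        (fun Dt => ∃ (B' : (D₀.regeom₄.baseThetaDatumThetaStandIn D₀.cuspGaloisRegeom₄ D₀.cuspClassesNormaliserStable_regeom₄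
              D₀.unramifiedTorsionMonodromyRegeom₄.toTorsionMonodromy D₀.arrowCoveringClaimsRegeom₄
              (D₀.unramifiedTorsionMonodromyRegeom₄.tau_inertia _) ES).DThetaBridge) (ι : Dt.J ≃ B'.J)
            (κ : ∀ j x, (B'.capsule (ι j) x).obj ≅ (Dt.capsule j).obj x)
            (γ : ∀ x, (B'.cod x).obj ≅ Dt.codomain.obj x),
            ∀ j x, Dt.poly j x = {g | ∃ f ∈ B'.poly (ι j) x, g = (κ j x).inv ≫ f.hom ≫ (γ x).hom})
        D₀.regeom₄.odd_l ∧
      (∀ B₁ B₂ : (D₀.regeom₄.baseKitThetaNFStandIn D₀.cuspGaloisRegeom₄ D₀.cuspClassesNormaliserStable_regeom₄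
          D₀.unramifiedTorsionMonodromyRegeom₄.toTorsionMonodromy D₀.arrowCoveringClaimsRegeom₄
          (D₀.unramifiedTorsionMonodromyRegeom₄.tau_inertia _)).DThetaPMBridge,
        Nat.card (PMBaseKit.DThetaBridgeData.Hom
          (B₁.thetaBridgeData (D₀.regeom₄.multKitThetaNFStandIn D₀.cuspGaloisRegeom₄ D₀.cuspClassesNormaliserStable_regeom₄
            D₀.unramifiedTorsionMonodromyRegeom₄.toTorsionMonodromy D₀.arrowCoveringClaimsRegeom₄
            (D₀.unramifiedTorsionMonodromyRegeom₄.tau_inertia _) ES) D₀.regeom₄.odd_l)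
          (B₂.thetaBridgeData (D₀.regeom₄.multKitThetaNFStandIn D₀.cuspGaloisRegeom₄ D₀.cuspClassesNormaliserStable_regeom₄
            D₀.unramifiedTorsionMonodromyRegeom₄.toTorsionMonodromy D₀.arrowCoveringClaimsRegeom₄
            (D₀.unramifiedTorsionMonodromyRegeom₄.tau_inertia _) ES) D₀.regeom₄.odd_l)) = 1) ∧
      Nonempty (D₀.regeom₄.baseKitThetaNFStandIn D₀.cuspGaloisRegeom₄ D₀.cuspClassesNormaliserStable_regeom₄
          D₀.unramifiedTorsionMonodromyRegeom₄.toTorsionMonodromy D₀.arrowCoveringClaimsRegeom₄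
          (D₀.unramifiedTorsionMonodromyRegeom₄.tau_inertia _)).DThetaPMBridge := by
  obtain ⟨χ, hχ⟩ := D₀.regeom₄.exists_decompAt_characterFamily_ne_one
  exact ⟨_, D₀.prop67_body_regeom₄ χ hχ⟩

end InitialThetaData
end Literature.IUT.HodgeTheaters
end
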